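import Summits.Langlands.Langlands.Statement
import Literature.NumberTheory.DiophantineGeometry.BcgpResiduallyA5bModular
import Literature.NumberTheory.Automorphic.IsAutomorphicAE
import Literature.NumberTheory.Automorphic.FreitasLeHungSiksekAbelianVariety
import HarnessLib

/-!
# F3 `_special` — the floor is LITERALLY the family at `g = 1` (line `GL2TypeSurfaceRealQuadratic`, crux
`ReciprocityUpToIrreducibility`, item stmt-Langlands-14328; G4 ladder-down generation 27)

`floor_one : fls2015_modular_abelianVariety_dimOne_realQuadratic → GL2TypeModularRealQuadratic 1`: the in-tree named fact
(Freitas–Le Hung–Siksek 2015, Thm. 1, arXiv:1310.7088 — every elliptic curve over a real quadratic field is modular — in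
abelian-variety / `GL₂` a.e.-Satake form, `Literature/NumberTheory/Automorphic/FreitasLeHungSiksekAbelianVariety.lean`, vendored by
this unit, p205662) IS the member `g = 1` of the dimension family of GL₂-type abelian varieties over real quadratic fields: a
one-dimensional `A` needs no coefficient field (the hypothesis `IsGL2Type A` is discarded), the framed dual `r` of `V_ℓ(A)` is the
fact's `r`, and the family's conclusion for an irreducible rank-2 Frobenius factor `ρ` of `r` follows from the fact's conclusion
for `r` by the sorry-free transport `satakeFrobCompatibleAE_of_isFrobFactorAE` (two monic degree-2 characteristic polynomials, one
dividing the other, coincide).  Witness regime: S restricted to `g = 1`, real quadratic `K` IS the 2015 theorem; nothing is known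
at `g = 2` (the rung).  Also recorded: `family_one_le` (the members `1 ≤ g < 2` are the floor).  No `sorry`.
-/

noncomputable section

set_option linter.dupNamespace false

open scoped MatrixGroups Matrix NumberField Classical
open Filter IsDedekindDomain IsDedekindDomain.HeightOneSpectrum CategoryTheory
open Literature.NumberTheory.Automorphic Literature.NumberTheory.GaloisRepresentations
open Literature.NumberTheory.PAdicHodge Literature.NumberTheory.DiophantineGeometry
open Literature.AlgebraicGeometry.Motives (AbelianVariety)
open NumberField
open Summit.Langlands

namespace Summit.Langlands.Langlands.Cruxes.ReciprocityUpToIrreducibility.GL2TypeSurfaceRealQuadratic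

/-! ## 0. The floor fact = `Literature.NumberTheory.Automorphic.fls2015_modular_abelianVariety_dimOne_realQuadratic`
(FLS 2015 Thm. 1 in abelian-variety / `GL₂` a.e.-Satake form; vendored p205662, commit 2a50369dd387). -/

/-! ## 1. Vocabulary: framed duals of Tate modules, GL₂-type, Frobenius-factor, the family -/

/-- `r` is the framed dual of `V_ℓ(A)` in the dual basis of `b` (verbatim the clause of the BCGP / FLS facts):
`r(γ) = [γ⁻¹]_bᵀ`, i.e. `H¹_ét(A_{K̄}, ℚ_ℓ) ⊗ ℚ̄_ℓ` framed. -/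
def IsFramedDualTate {K : Type} [Field K] [NumberField K] (A : AbelianVariety K) (ℓ : ℕ) [Fact ℓ.Prime]
    {m : ℕ} (b : Module.Basis (Fin m) ℚ_[ℓ] (A.rationalTateModule ℓ))
    (r : FramedGaloisRep K (PadicAlgCl ℓ) m) : Prop :=
  ∀ g : Field.absoluteGaloisGroup K,
    (r g).val = ((LinearMap.toMatrix b b (A.rationalTateRep ℓ g⁻¹)).map (algebraMap ℚ_[ℓ] (PadicAlgCl ℓ))).transpose

/-- **`A` is of GL₂-type** (Ribet): a number field `E` with `[E:ℚ] = dim A` acts on `A` by `K`-rational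
endomorphisms (`E →+* End⁰(A) = A.endAlgebra`). At `dim A = 1` take `E = ℚ`. -/
def IsGL2Type {K : Type} [Field K] (A : AbelianVariety K) : Prop :=
  ∃ (E : Type) (_ : Field E) (_ : NumberField E), Module.finrank ℚ E = A.dim ∧ Nonempty (E →+* A.endAlgebra)

/-- **`ρ` is an a.e. Frobenius factor of `r`**: at all but finitely many places, the characteristic polynomial of
every arithmetic Frobenius under `ρ` divides the one under `r` (for `ρ = ρ_{A,λ}^∨` a `λ`-adic constituent of
`H¹(A) ⊗ ℚ̄_ℓ` this holds at every good place). -/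
def IsFrobFactorAE {K : Type} [Field K] [NumberField K] {ℓ : ℕ} [Fact ℓ.Prime] {n m : ℕ}
    (ρ : FramedGaloisRep K (PadicAlgCl ℓ) n) (r : FramedGaloisRep K (PadicAlgCl ℓ) m) : Prop :=
  ∀ᶠ v : HeightOneSpectrum (𝓞 K) in cofinite, ∀ 𝔓 ∈ v.primesAbove, ∀ σ : Field.absoluteGaloisGroup K,
    IsArithFrobAt (𝓞 K) σ 𝔓 → FramedRep.charpoly ρ σ ∣ FramedRep.charpoly r σ

/-- **THE RUNG FAMILY, dial = `g = dim A = [E:ℚ]`.**  For every real quadratic field `K`, every GL₂-type abelian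
variety `A/K` of dimension `g`, every prime `ℓ`, framed dual `r` of `V_ℓ(A)` and every irreducible, a.e.-unramified,
de Rham (for Fontaine's pinned datum) `2`-dimensional `ρ : Γ_K → GL₂(ℚ̄_ℓ)` which is an a.e. Frobenius factor of `r`,
`ρ` is automorphic in the summit's a.e.-Satake form: some automorphic `π` of `GL₂(𝔸_K)` has Satake parameters matching
`det(X − ρ(Frob_v))` at almost all `v`. -/
def GL2TypeModularRealQuadratic (g : ℕ) : Prop :=
  ∀ (K : Type) [Field K] [NumberField K] [IsTotallyReal K], Module.finrank ℚ K = 2 →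
    ∀ (A : AbelianVariety K), A.dim = g → IsGL2Type A →
      ∀ (ℓ : ℕ) [Fact ℓ.Prime] (b : Module.Basis (Fin (2 * g)) ℚ_[ℓ] (A.rationalTateModule ℓ))
        (r : FramedGaloisRep K (PadicAlgCl ℓ) (2 * g)), IsFramedDualTate A ℓ b r →
        ∀ ρ : FramedGaloisRep K (PadicAlgCl ℓ) 2, ρ.toGaloisRep.IsIrreducible →
          (∀ᶠ v : HeightOneSpectrum (𝓞 K) in cofinite, ρ.IsUnramifiedAt v) →
          (∀ (w : HeightOneSpectrum (𝓞 K)) (hw : ((ℓ : ℕ) : 𝓞 K) ∈ w.asIdeal),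
              (fontainePstAdicCompletion w ℓ hw).IsDeRhamFramed (ρ.toLocal w)) →
          IsFrobFactorAE ρ r →
          ∀ (hcpt : isCompact_glFiniteIntegralLevel 2 K) (ι : PadicAlgCl ℓ ≃+* ℂ),
            ∃ π : AutomorphicRepData (AutomorphyDatum.gl 2 K hcpt), SatakeFrobCompatibleAE ι π ρ

/-- **THE RUNG (θ29 = 2)**: GL₂-type abelian SURFACES over real quadratic fields. -/
def GL2TypeSurfaceRealQuadratic : Prop := GL2TypeModularRealQuadratic 2

/-- **Above the rung (θ29 ≥ 3)**: GL₂-type abelian varieties of every dimension `≥ 3` over real quadratic fields. -/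
def GL2TypeHigherRealQuadratic : Prop := ∀ g : ℕ, 3 ≤ g → GL2TypeModularRealQuadratic g

/-! ## 2. The floor `g = 1` from the fact; `g = 0` vacuous; the family from its members (sorry-free) -/

/-- Transport of the a.e.-Satake clause along an a.e. Frobenius factor of the SAME rank: the two monic degree-`n`
characteristic polynomials coincide. -/
theorem satakeFrobCompatibleAE_of_isFrobFactorAE {K : Type} [Field K] [NumberField K] {ℓ : ℕ} [Fact ℓ.Prime]
    {n : ℕ} {hcpt : isCompact_glFiniteIntegralLevel n K} (ι : PadicAlgCl ℓ ≃+* ℂ)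
    (π : AutomorphicRepData (AutomorphyDatum.gl n K hcpt)) (ρ r : FramedGaloisRep K (PadicAlgCl ℓ) n)
    (hunr : ∀ᶠ v : HeightOneSpectrum (𝓞 K) in cofinite, ρ.IsUnramifiedAt v) (hfac : IsFrobFactorAE ρ r)
    (hr : SatakeFrobCompatibleAE ι π r) : SatakeFrobCompatibleAE ι π ρ := by
  filter_upwards [hunr, hfac, hr] with v hv hdvd hv3
  obtain ⟨a, ha, -, hchar⟩ := hv3
  refine ⟨a, ha, hv, fun 𝔓 h𝔓 σ hσ => ?_⟩
  have hrσ : FramedRep.charpoly r σ = arithFrobPolyOfSatake ι v.residueCard 1 a := hchar 𝔓 h𝔓 σ hσ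
  have hd : FramedRep.charpoly ρ σ ∣ FramedRep.charpoly r σ := hdvd 𝔓 h𝔓 σ hσ
  have hmρ : (FramedRep.charpoly ρ σ).Monic := Matrix.charpoly_monic _
  have hmr : (FramedRep.charpoly r σ).Monic := Matrix.charpoly_monic _
  have hdeg : (FramedRep.charpoly r σ).natDegree ≤ (FramedRep.charpoly ρ σ).natDegree := by
    simp only [FramedRep.charpoly, Matrix.charpoly_natDegree_eq_dim, Fintype.card_fin, le_refl]
  rw [← hrσ]
  exact (Polynomial.eq_of_monic_of_dvd_of_natDegree_le hmρ hmr hd hdeg).symm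

/-- **F3: the family at `g = 1` from the floor fact** (FLS 2015 Thm. 1, AV form): a one-dimensional abelian variety
needs no `E` (the hypothesis `IsGL2Type` is discarded), `r` is `2`-dimensional, and the a.e.-Satake clause passes from
`r` to its rank-`2` Frobenius factor `ρ`. -/
theorem floor_one (h : fls2015_modular_abelianVariety_dimOne_realQuadratic) : GL2TypeModularRealQuadratic 1 := by
  intro K _ _ _ hK A hdim _hGL ℓ _ b r hfr ρ _hirr hunr _hdR hfac hcpt ι
  obtain ⟨π, -, hπ⟩ := h K hK A hdim ℓ b r hfr hcpt ι
  exact ⟨π.1, satakeFrobCompatibleAE_of_isFrobFactorAE ι π.1 ρ r hunr hfac hπ⟩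

/-- The members below the rung (`1 ≤ g < 2`) are the floor. -/
theorem family_one_le (h1 : fls2015_modular_abelianVariety_dimOne_realQuadratic) (g : ℕ) (hg : 1 ≤ g) (hg' : g < 2) :
    GL2TypeModularRealQuadratic g := by
  interval_cases g
  exact floor_one h1

end Summit.Langlands.Langlands.Cruxes.ReciprocityUpToIrreducibility.GL2TypeSurfaceRealQuadratic

end
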